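import Summits.NavierStokesRegularity.NavierStokesRegularity.Theorems.ExtremiserTransienceNearExtremalTransienceExtremiserLiouvilleConstantSpeedSlideHessianTwoBound
import HarnessLib

/-!
# Crux `ExtremiserTransience.NearExtremalTransience` (stmt-NavierStokesRegularity-21883), line `extremiser_liouville`,
# stub K1b — THE `V₂`-LINES OF R6b, INTEGRATED (record §15/§18)

`--supports stmt-NavierStokesRegularity-21883` (helper).  Author: prover seat `ns-el-k1b` (g9).

The indefinite entries of the `W′`- and `Z′`-lines of (INEQ)₃ involve `V₂` (`V = v − c`): `|∇_hV₂|²` (W′) and `|∇∇_hV₂|²` (Z′, after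
`…SlidePalinstrophyCancellation`).  For the constant-speed jet (`‖v‖ ≡ M`, `c = (0,0,c₂)`, `‖c‖ = M`) the pointwise kinematics of
`…SlideJetKinematics` / `…SlideHessianTwoBound` integrate, against any continuous bounded weight `w ≥ 0` supported where `‖v − c‖ ≤ σ`, to
```
  M²∫w[(∂₀V₂)² + (∂₁V₂)²] ≤ σ²∫w[‖∂₀v‖² + ‖∂₁v‖²],
  M²∫w·Σᵢ[(∂ᵢ∂₀V)₂² + (∂ᵢ∂₁V)₂²] ≤ 2∫w|Dv|⁴_F + 2σ²∫w(|D∂₀v|²_F + |D∂₁v|²_F),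
```
the right-hand sides being the coercive `W′`-entries, the quartic-gradient line (`…SlideGradientL4*`) and the `(P)`-form of the palinstrophy.
* `sq_coord_two_eq_of_axis` : `c₂² = M²` for `c = (0,0,c₂)`, `‖c‖ = M`;
* `sq_mul_sq_fderiv_apply_two_le` : `M²(∂ᵤV₂)² ≤ ‖V‖²‖∂ᵤv‖²` pointwise;
* `integral_weight_sq_hgrad_two_le` , `integral_weight_sq_hessian_two_le` : the two displayed inequalities.

WHAT THIS IS NOT: K1b is NOT proved; nothing here proves NS regularity. [folklore]
-/

noncomputable section

open Set Filter Topology MeasureTheory Metric Function InnerProductSpace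
open scoped ENNReal NNReal Topology InnerProductSpace RealInnerProductSpace ContDiff
open Literature.Analysis.FluidPDE Literature.Analysis

namespace Summit.NavierStokesRegularity.NavierStokesRegularity.Theorems

-- the problem directory repeats the summit name (`NavierStokesRegularity/NavierStokesRegularity`)
set_option linter.dupNamespace false

namespace ExtremiserLiouville

variable {v : EuclideanSpace ℝ (Fin 3) → EuclideanSpace ℝ (Fin 3)} {c : EuclideanSpace ℝ (Fin 3)} {M : ℝ} {w : EuclideanSpace ℝ (Fin 3) → ℝ}

/-- `c₂² = M²` for `c = (0, 0, c₂)` with `‖c‖ = M`. [folklore] -/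
theorem sq_coord_two_eq_of_axis (hc0 : c 0 = 0) (hc1 : c 1 = 0) (hcM : ‖c‖ = M) : c 2 ^ 2 = M ^ 2 := by
  have h := EuclideanSpace.norm_sq_eq c
  rw [hcM, Fin.sum_univ_three] at h
  simp only [Real.norm_eq_abs, sq_abs, hc0, hc1] at h
  linarith

/-- **`M²(∂ᵤV₂)² ≤ ‖V‖²‖∂ᵤv‖²`** pointwise (`V = v − c`, constant speed, `c = (0,0,c₂)`, `‖c‖ = M`). [folklore] -/
theorem sq_mul_sq_fderiv_apply_two_le (hv : Differentiable ℝ v) (hM : ∀ x, ‖v x‖ = M) (hc0 : c 0 = 0) (hc1 : c 1 = 0)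
    (hcM : ‖c‖ = M) (x u : EuclideanSpace ℝ (Fin 3)) : M ^ 2 * fderiv ℝ v x u 2 ^ 2 ≤ ‖v x - c‖ ^ 2 * ‖fderiv ℝ v x u‖ ^ 2 := by
  have h := abs_coord_two_mul_fderiv_apply_two_le hv hM hc0 hc1 x u
  have h0 : 0 ≤ |c 2| * |fderiv ℝ v x u 2| := mul_nonneg (abs_nonneg _) (abs_nonneg _)
  have h2 := pow_le_pow_left₀ h0 h 2
  rw [mul_pow, sq_abs, sq_abs, sq_coord_two_eq_of_axis hc0 hc1 hcM, mul_pow] at h2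
  exact h2

/-- **The `W′`-line `V₂`-term**: `M²∫w[(∂₀V₂)² + (∂₁V₂)²] ≤ σ²∫w[‖∂₀v‖² + ‖∂₁v‖²]` for a continuous weight `0 ≤ w ≤ K` with
`‖v − c‖ ≤ σ` where `w ≠ 0`, `Dv ∈ L²`. [folklore] -/
theorem integral_weight_sq_hgrad_two_le (hv : ContDiff ℝ 1 v) (hM : ∀ x, ‖v x‖ = M) (hc0 : c 0 = 0) (hc1 : c 1 = 0)
    (hcM : ‖c‖ = M) (hw : Continuous w) {K σ : ℝ} (hw0 : ∀ x, 0 ≤ w x) (hwK : ∀ x, w x ≤ K)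
    (hσ : ∀ x, w x ≠ 0 → ‖v x - c‖ ≤ σ) (i1 : Integrable (fun y => ‖fderiv ℝ v y‖ ^ 2) (volume : Measure (EuclideanSpace ℝ (Fin 3)))) :
    M ^ 2 * (∫ x : EuclideanSpace ℝ (Fin 3), w x * (fderiv ℝ v x (EuclideanSpace.single (0 : Fin 3) (1 : ℝ)) 2 ^ 2 + fderiv ℝ v x (EuclideanSpace.single (1 : Fin 3) (1 : ℝ)) 2 ^ 2)) ≤
      σ ^ 2 * ∫ x : EuclideanSpace ℝ (Fin 3), w x * (‖fderiv ℝ v x (EuclideanSpace.single (0 : Fin 3) (1 : ℝ))‖ ^ 2 + ‖fderiv ℝ v x (EuclideanSpace.single (1 : Fin 3) (1 : ℝ))‖ ^ 2) := by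
  have hvd : Differentiable ℝ v := hv.differentiable one_ne_zero
  have hK0 : 0 ≤ K := (hw0 0).trans (hwK 0)
  have n0 : ‖(EuclideanSpace.single (0 : Fin 3) (1 : ℝ) : EuclideanSpace ℝ (Fin 3))‖ = 1 := by rw [PiLp.norm_single, norm_one]
  have n1 : ‖(EuclideanSpace.single (1 : Fin 3) (1 : ℝ) : EuclideanSpace ℝ (Fin 3))‖ = 1 := by rw [PiLp.norm_single, norm_one]
  have nu : ∀ (x : EuclideanSpace ℝ (Fin 3)) (e : EuclideanSpace ℝ (Fin 3)), ‖e‖ = 1 → ‖fderiv ℝ v x e‖ ≤ ‖fderiv ℝ v x‖ := fun x e he => by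
    simpa [he] using (fderiv ℝ v x).le_opNorm e
  have n2 : ∀ z : EuclideanSpace ℝ (Fin 3), z 2 ^ 2 ≤ ‖z‖ ^ 2 := fun z => by
    rw [← sq_abs]; exact pow_le_pow_left₀ (abs_nonneg _) (by simpa [Real.norm_eq_abs] using PiLp.norm_apply_le (p := 2) z 2) 2
  have cD : ∀ e : EuclideanSpace ℝ (Fin 3), Continuous fun x => fderiv ℝ v x e := fun e => (hv.continuous_fderiv one_ne_zero).clm_apply continuous_const
  have cD2 : ∀ e : EuclideanSpace ℝ (Fin 3), Continuous fun x => fderiv ℝ v x e 2 := fun e =>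
    (EuclideanSpace.proj (2 : Fin 3) : EuclideanSpace ℝ (Fin 3) →L[ℝ] ℝ).continuous.comp (cD e)
  -- pointwise
  have hpt : ∀ x : EuclideanSpace ℝ (Fin 3), M ^ 2 * (w x * (fderiv ℝ v x (EuclideanSpace.single (0 : Fin 3) (1 : ℝ)) 2 ^ 2 + fderiv ℝ v x (EuclideanSpace.single (1 : Fin 3) (1 : ℝ)) 2 ^ 2)) ≤
      σ ^ 2 * (w x * (‖fderiv ℝ v x (EuclideanSpace.single (0 : Fin 3) (1 : ℝ))‖ ^ 2 + ‖fderiv ℝ v x (EuclideanSpace.single (1 : Fin 3) (1 : ℝ))‖ ^ 2)) := fun x => by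
    by_cases h0 : w x = 0
    · rw [h0]; simp
    have hVσ : ‖v x - c‖ ^ 2 ≤ σ ^ 2 := pow_le_pow_left₀ (norm_nonneg _) (hσ x h0) 2
    have a0 := sq_mul_sq_fderiv_apply_two_le hvd hM hc0 hc1 hcM x (EuclideanSpace.single (0 : Fin 3) (1 : ℝ))
    have a1 := sq_mul_sq_fderiv_apply_two_le hvd hM hc0 hc1 hcM x (EuclideanSpace.single (1 : Fin 3) (1 : ℝ))
    have b0 := mul_le_mul_of_nonneg_right hVσ (sq_nonneg ‖fderiv ℝ v x (EuclideanSpace.single (0 : Fin 3) (1 : ℝ))‖)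
    have b1 := mul_le_mul_of_nonneg_right hVσ (sq_nonneg ‖fderiv ℝ v x (EuclideanSpace.single (1 : Fin 3) (1 : ℝ))‖)
    have hw := hw0 x
    nlinarith [mul_le_mul_of_nonneg_left (a0.trans b0) hw, mul_le_mul_of_nonneg_left (a1.trans b1) hw]
  -- integrability
  have iL : Integrable (fun x : EuclideanSpace ℝ (Fin 3) => w x * (fderiv ℝ v x (EuclideanSpace.single (0 : Fin 3) (1 : ℝ)) 2 ^ 2 + fderiv ℝ v x (EuclideanSpace.single (1 : Fin 3) (1 : ℝ)) 2 ^ 2)) volume := by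
    refine (i1.const_mul (2 * K)).mono' (hw.mul (((cD2 _).pow 2).add ((cD2 _).pow 2))).aestronglyMeasurable (Eventually.of_forall fun x => ?_)
    rw [Real.norm_eq_abs, abs_of_nonneg (mul_nonneg (hw0 x) (by positivity))]
    have h0 := (n2 (fderiv ℝ v x (EuclideanSpace.single (0 : Fin 3) (1 : ℝ)))).trans (pow_le_pow_left₀ (norm_nonneg _) (nu x _ n0) 2)
    have h1 := (n2 (fderiv ℝ v x (EuclideanSpace.single (1 : Fin 3) (1 : ℝ)))).trans (pow_le_pow_left₀ (norm_nonneg _) (nu x _ n1) 2)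
    calc w x * (fderiv ℝ v x (EuclideanSpace.single (0 : Fin 3) (1 : ℝ)) 2 ^ 2 + fderiv ℝ v x (EuclideanSpace.single (1 : Fin 3) (1 : ℝ)) 2 ^ 2) ≤ K * (‖fderiv ℝ v x‖ ^ 2 + ‖fderiv ℝ v x‖ ^ 2) :=
          mul_le_mul (hwK x) (add_le_add h0 h1) (by positivity) hK0
      _ = 2 * K * ‖fderiv ℝ v x‖ ^ 2 := by ring
  have iR : Integrable (fun x : EuclideanSpace ℝ (Fin 3) => w x * (‖fderiv ℝ v x (EuclideanSpace.single (0 : Fin 3) (1 : ℝ))‖ ^ 2 + ‖fderiv ℝ v x (EuclideanSpace.single (1 : Fin 3) (1 : ℝ))‖ ^ 2)) volume := by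
    refine (i1.const_mul (2 * K)).mono' (hw.mul (((cD _).norm.pow 2).add ((cD _).norm.pow 2))).aestronglyMeasurable (Eventually.of_forall fun x => ?_)
    rw [Real.norm_eq_abs, abs_of_nonneg (mul_nonneg (hw0 x) (by positivity))]
    have h0 := pow_le_pow_left₀ (norm_nonneg _) (nu x _ n0) 2
    have h1 := pow_le_pow_left₀ (norm_nonneg _) (nu x _ n1) 2
    calc w x * (‖fderiv ℝ v x (EuclideanSpace.single (0 : Fin 3) (1 : ℝ))‖ ^ 2 + ‖fderiv ℝ v x (EuclideanSpace.single (1 : Fin 3) (1 : ℝ))‖ ^ 2) ≤ K * (‖fderiv ℝ v x‖ ^ 2 + ‖fderiv ℝ v x‖ ^ 2) :=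
          mul_le_mul (hwK x) (add_le_add h0 h1) (by positivity) hK0
      _ = 2 * K * ‖fderiv ℝ v x‖ ^ 2 := by ring
  rw [← integral_const_mul, ← integral_const_mul]
  exact integral_mono (iL.const_mul _) (iR.const_mul _) hpt

/-- **The `Z′`-line `V₂`-term**: `M²∫w·Σᵢ[(∂ᵢ∂₀V)₂² + (∂ᵢ∂₁V)₂²] ≤ 2∫w|Dv|⁴_F + 2σ²∫w(|D∂₀v|²_F + |D∂₁v|²_F)` for a continuous weight
`0 ≤ w ≤ K` with `‖v − c‖ ≤ σ` where `w ≠ 0`, `‖Dv‖ ≤ B`, `Dv, D²v ∈ L²`. [folklore] -/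
theorem integral_weight_sq_hessian_two_le (hv : ContDiff ℝ ∞ v) (hM : ∀ x, ‖v x‖ = M) (hc0 : c 0 = 0) (hc1 : c 1 = 0)
    (hcM : ‖c‖ = M) (hw : Continuous w) {K σ B : ℝ} (hw0 : ∀ x, 0 ≤ w x) (hwK : ∀ x, w x ≤ K)
    (hσ : ∀ x, w x ≠ 0 → ‖v x - c‖ ≤ σ) (hB : ∀ x, ‖fderiv ℝ v x‖ ≤ B)
    (i1 : Integrable (fun y => ‖fderiv ℝ v y‖ ^ 2) (volume : Measure (EuclideanSpace ℝ (Fin 3))))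
    (i2 : Integrable (fun y => ‖iteratedFDeriv ℝ 2 v y‖ ^ 2) (volume : Measure (EuclideanSpace ℝ (Fin 3)))) :
    M ^ 2 * (∫ x : EuclideanSpace ℝ (Fin 3), w x * (∑ i : Fin 3, (fderiv ℝ (fun y => fderiv ℝ v y (EuclideanSpace.single (0 : Fin 3) (1 : ℝ))) x (EuclideanSpace.basisFun (Fin 3) ℝ i) 2 ^ 2 + fderiv ℝ (fun y => fderiv ℝ v y (EuclideanSpace.single (1 : Fin 3) (1 : ℝ))) x (EuclideanSpace.basisFun (Fin 3) ℝ i) 2 ^ 2))) ≤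
      2 * (∫ x : EuclideanSpace ℝ (Fin 3), w x * frobeniusNormSq (fderiv ℝ v x) ^ 2) +
        2 * σ ^ 2 * ∫ x : EuclideanSpace ℝ (Fin 3), w x * (frobeniusNormSq (fderiv ℝ (fun y => fderiv ℝ v y (EuclideanSpace.single (0 : Fin 3) (1 : ℝ))) x) +
          frobeniusNormSq (fderiv ℝ (fun y => fderiv ℝ v y (EuclideanSpace.single (1 : Fin 3) (1 : ℝ))) x)) := by
  have lt2 : (2 : WithTop ℕ∞) ≤ ((⊤ : ℕ∞) : WithTop ℕ∞) := WithTop.coe_le_coe.mpr le_top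
  have hv2 : ContDiff ℝ 2 v := hv.of_le lt2
  have hK0 : 0 ≤ K := (hw0 0).trans (hwK 0)
  have hB0 : 0 ≤ B := (norm_nonneg _).trans (hB 0)
  have hc2 : c 2 ^ 2 = M ^ 2 := sq_coord_two_eq_of_axis hc0 hc1 hcM
  have nb : ∀ k : Fin 3, ‖EuclideanSpace.basisFun (Fin 3) ℝ k‖ = 1 := fun k => (EuclideanSpace.basisFun (Fin 3) ℝ).orthonormal.norm_eq_one k
  have hu : ∀ e : EuclideanSpace ℝ (Fin 3), ContDiff ℝ ∞ fun y => fderiv ℝ v y e := fun e =>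
    (hv.fderiv_right (m := ∞) (by exact_mod_cast le_rfl)).clm_apply contDiff_const
  have nDu : ∀ (e : EuclideanSpace ℝ (Fin 3)) (x : EuclideanSpace ℝ (Fin 3)), ‖e‖ = 1 → ‖fderiv ℝ (fun y => fderiv ℝ v y e) x‖ ≤ ‖iteratedFDeriv ℝ 2 v x‖ := fun e x he => by
    rw [fderiv_fderiv_apply_eq hv2 x]
    have e1 : ‖fderiv ℝ (fderiv ℝ v) x‖ = ‖iteratedFDeriv ℝ 2 v x‖ := by
      rw [← norm_iteratedFDeriv_zero (𝕜 := ℝ) (f := fderiv ℝ (fderiv ℝ v)), norm_iteratedFDeriv_fderiv, norm_iteratedFDeriv_fderiv]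
    rw [← e1]
    simpa [he] using (fderiv ℝ (fderiv ℝ v) x).le_opNorm e
  have n0 : ‖(EuclideanSpace.single (0 : Fin 3) (1 : ℝ) : EuclideanSpace ℝ (Fin 3))‖ = 1 := by rw [PiLp.norm_single, norm_one]
  have n1 : ‖(EuclideanSpace.single (1 : Fin 3) (1 : ℝ) : EuclideanSpace ℝ (Fin 3))‖ = 1 := by rw [PiLp.norm_single, norm_one]
  have frob_le : ∀ Lm : EuclideanSpace ℝ (Fin 3) →L[ℝ] EuclideanSpace ℝ (Fin 3), frobeniusNormSq Lm ≤ 3 * ‖Lm‖ ^ 2 := fun Lm => by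
    rw [frobeniusNormSq_eq_sum (EuclideanSpace.basisFun (Fin 3) ℝ)]
    have := sum_sq_norm_apply_le_card_mul_sq_opNorm (EuclideanSpace.basisFun (Fin 3) ℝ) Lm
    rwa [Fintype.card_fin, Nat.cast_ofNat] at this
  have hF0 : ∀ Lm : EuclideanSpace ℝ (Fin 3) →L[ℝ] EuclideanSpace ℝ (Fin 3), 0 ≤ frobeniusNormSq Lm := fun Lm => frobeniusNormSq_nonneg _
  -- pointwise
  have hpt : ∀ x : EuclideanSpace ℝ (Fin 3), M ^ 2 * (w x * (∑ i : Fin 3, (fderiv ℝ (fun y => fderiv ℝ v y (EuclideanSpace.single (0 : Fin 3) (1 : ℝ))) x (EuclideanSpace.basisFun (Fin 3) ℝ i) 2 ^ 2 + fderiv ℝ (fun y => fderiv ℝ v y (EuclideanSpace.single (1 : Fin 3) (1 : ℝ))) x (EuclideanSpace.basisFun (Fin 3) ℝ i) 2 ^ 2))) ≤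
      2 * (w x * frobeniusNormSq (fderiv ℝ v x) ^ 2) + 2 * σ ^ 2 * (w x * (frobeniusNormSq (fderiv ℝ (fun y => fderiv ℝ v y (EuclideanSpace.single (0 : Fin 3) (1 : ℝ))) x) +
          frobeniusNormSq (fderiv ℝ (fun y => fderiv ℝ v y (EuclideanSpace.single (1 : Fin 3) (1 : ℝ))) x))) := fun x => by
    by_cases h0 : w x = 0
    · rw [h0]; simp
    have hVσ : ‖v x - c‖ ^ 2 ≤ σ ^ 2 := pow_le_pow_left₀ (norm_nonneg _) (hσ x h0) 2
    have h := sq_coord_two_mul_sum_sq_hessian_two_le hv2 hM hc0 hc1 x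
    rw [hc2] at h
    have hw := hw0 x
    have hF := add_nonneg (hF0 (fderiv ℝ (fun y => fderiv ℝ v y (EuclideanSpace.single (0 : Fin 3) (1 : ℝ))) x)) (hF0 (fderiv ℝ (fun y => fderiv ℝ v y (EuclideanSpace.single (1 : Fin 3) (1 : ℝ))) x))
    nlinarith [mul_le_mul_of_nonneg_left h hw, mul_le_mul_of_nonneg_right hVσ hF, mul_nonneg hw hF]
  -- integrability
  have cHe : ∀ (e : EuclideanSpace ℝ (Fin 3)) (i : Fin 3), Continuous fun x : EuclideanSpace ℝ (Fin 3) => fderiv ℝ (fun y => fderiv ℝ v y e) x (EuclideanSpace.basisFun (Fin 3) ℝ i) 2 := fun e i =>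
    (EuclideanSpace.proj (2 : Fin 3) : EuclideanSpace ℝ (Fin 3) →L[ℝ] ℝ).continuous.comp
      ((((hu e).fderiv_right (m := ∞) (by exact_mod_cast le_rfl)).clm_apply contDiff_const).continuous)
  have iL : Integrable (fun x : EuclideanSpace ℝ (Fin 3) => w x * (∑ i : Fin 3, (fderiv ℝ (fun y => fderiv ℝ v y (EuclideanSpace.single (0 : Fin 3) (1 : ℝ))) x (EuclideanSpace.basisFun (Fin 3) ℝ i) 2 ^ 2 + fderiv ℝ (fun y => fderiv ℝ v y (EuclideanSpace.single (1 : Fin 3) (1 : ℝ))) x (EuclideanSpace.basisFun (Fin 3) ℝ i) 2 ^ 2))) volume := by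
    refine (i2.const_mul (6 * K)).mono' (hw.mul (continuous_finsetSum _ fun i _ => ((cHe _ i).pow 2).add ((cHe _ i).pow 2))).aestronglyMeasurable
      (Eventually.of_forall fun x => ?_)
    rw [Real.norm_eq_abs, abs_of_nonneg (mul_nonneg (hw0 x) (Finset.sum_nonneg fun i _ => by positivity))]
    have hk : ∀ (e : EuclideanSpace ℝ (Fin 3)) (i : Fin 3), ‖e‖ = 1 → fderiv ℝ (fun y => fderiv ℝ v y e) x (EuclideanSpace.basisFun (Fin 3) ℝ i) 2 ^ 2 ≤ ‖iteratedFDeriv ℝ 2 v x‖ ^ 2 :=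
      fun e i he => by
      have h1 : |fderiv ℝ (fun y => fderiv ℝ v y e) x (EuclideanSpace.basisFun (Fin 3) ℝ i) 2| ≤ ‖fderiv ℝ (fun y => fderiv ℝ v y e) x (EuclideanSpace.basisFun (Fin 3) ℝ i)‖ := by
        simpa [Real.norm_eq_abs] using PiLp.norm_apply_le (p := 2) (fderiv ℝ (fun y => fderiv ℝ v y e) x (EuclideanSpace.basisFun (Fin 3) ℝ i)) 2
      have h2 : ‖fderiv ℝ (fun y => fderiv ℝ v y e) x (EuclideanSpace.basisFun (Fin 3) ℝ i)‖ ≤ ‖iteratedFDeriv ℝ 2 v x‖ :=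
        ((fderiv ℝ (fun y => fderiv ℝ v y e) x).le_opNorm _).trans (by rw [nb i, mul_one]; exact nDu e x he)
      rw [← sq_abs]; exact pow_le_pow_left₀ (abs_nonneg _) (h1.trans h2) 2
    calc w x * (∑ i : Fin 3, (fderiv ℝ (fun y => fderiv ℝ v y (EuclideanSpace.single (0 : Fin 3) (1 : ℝ))) x (EuclideanSpace.basisFun (Fin 3) ℝ i) 2 ^ 2 + fderiv ℝ (fun y => fderiv ℝ v y (EuclideanSpace.single (1 : Fin 3) (1 : ℝ))) x (EuclideanSpace.basisFun (Fin 3) ℝ i) 2 ^ 2)) ≤ K * ∑ i : Fin 3, (‖iteratedFDeriv ℝ 2 v x‖ ^ 2 + ‖iteratedFDeriv ℝ 2 v x‖ ^ 2) :=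
          mul_le_mul (hwK x) (Finset.sum_le_sum fun i _ => add_le_add (hk _ i n0) (hk _ i n1))
            (Finset.sum_nonneg fun i _ => by positivity) hK0
      _ = 6 * K * ‖iteratedFDeriv ℝ 2 v x‖ ^ 2 := by simp; ring
  have iR1 : Integrable (fun x : EuclideanSpace ℝ (Fin 3) => w x * frobeniusNormSq (fderiv ℝ v x) ^ 2) volume := by
    refine (i1.const_mul (9 * K * B ^ 2)).mono' (hw.mul ((continuous_frobeniusNormSq_fderiv hv (by simp)).pow 2)).aestronglyMeasurable
      (Eventually.of_forall fun x => ?_)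
    rw [Real.norm_eq_abs, abs_of_nonneg (mul_nonneg (hw0 x) (sq_nonneg _))]
    have h1 := frob_le (fderiv ℝ v x); have h2 := hB x; have hP := norm_nonneg (fderiv ℝ v x); have h3 := hF0 (fderiv ℝ v x)
    have h4 : ‖fderiv ℝ v x‖ ^ 2 ≤ B ^ 2 := pow_le_pow_left₀ hP h2 2
    calc w x * frobeniusNormSq (fderiv ℝ v x) ^ 2 ≤ K * ((3 * ‖fderiv ℝ v x‖ ^ 2) * (3 * B ^ 2)) := by
          refine mul_le_mul (hwK x) ?_ (sq_nonneg _) hK0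
          rw [sq]; exact mul_le_mul h1 (h1.trans (by nlinarith)) h3 (by positivity)
      _ = 9 * K * B ^ 2 * ‖fderiv ℝ v x‖ ^ 2 := by ring
  have iR2 : Integrable (fun x : EuclideanSpace ℝ (Fin 3) => w x * (frobeniusNormSq (fderiv ℝ (fun y => fderiv ℝ v y (EuclideanSpace.single (0 : Fin 3) (1 : ℝ))) x) +
      frobeniusNormSq (fderiv ℝ (fun y => fderiv ℝ v y (EuclideanSpace.single (1 : Fin 3) (1 : ℝ))) x))) volume := by
    refine (i2.const_mul (6 * K)).mono' (hw.mul ((continuous_frobeniusNormSq_fderiv (hu _) (by simp)).add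
      (continuous_frobeniusNormSq_fderiv (hu _) (by simp)))).aestronglyMeasurable (Eventually.of_forall fun x => ?_)
    rw [Real.norm_eq_abs, abs_of_nonneg (mul_nonneg (hw0 x) (add_nonneg (hF0 _) (hF0 _)))]
    have h0 : frobeniusNormSq (fderiv ℝ (fun y => fderiv ℝ v y (EuclideanSpace.single (0 : Fin 3) (1 : ℝ))) x) ≤ 3 * ‖iteratedFDeriv ℝ 2 v x‖ ^ 2 :=
      (frob_le _).trans (by nlinarith [nDu _ x n0, norm_nonneg (fderiv ℝ (fun y => fderiv ℝ v y (EuclideanSpace.single (0 : Fin 3) (1 : ℝ))) x)])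
    have h1 : frobeniusNormSq (fderiv ℝ (fun y => fderiv ℝ v y (EuclideanSpace.single (1 : Fin 3) (1 : ℝ))) x) ≤ 3 * ‖iteratedFDeriv ℝ 2 v x‖ ^ 2 :=
      (frob_le _).trans (by nlinarith [nDu _ x n1, norm_nonneg (fderiv ℝ (fun y => fderiv ℝ v y (EuclideanSpace.single (1 : Fin 3) (1 : ℝ))) x)])
    calc w x * (frobeniusNormSq (fderiv ℝ (fun y => fderiv ℝ v y (EuclideanSpace.single (0 : Fin 3) (1 : ℝ))) x) + frobeniusNormSq (fderiv ℝ (fun y => fderiv ℝ v y (EuclideanSpace.single (1 : Fin 3) (1 : ℝ))) x))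
        ≤ K * (3 * ‖iteratedFDeriv ℝ 2 v x‖ ^ 2 + 3 * ‖iteratedFDeriv ℝ 2 v x‖ ^ 2) :=
          mul_le_mul (hwK x) (add_le_add h0 h1) (add_nonneg (hF0 _) (hF0 _)) hK0
      _ = 6 * K * ‖iteratedFDeriv ℝ 2 v x‖ ^ 2 := by ring
  have iR : Integrable (fun x : EuclideanSpace ℝ (Fin 3) => 2 * (w x * frobeniusNormSq (fderiv ℝ v x) ^ 2) + 2 * σ ^ 2 * (w x *
      (frobeniusNormSq (fderiv ℝ (fun y => fderiv ℝ v y (EuclideanSpace.single (0 : Fin 3) (1 : ℝ))) x) + frobeniusNormSq (fderiv ℝ (fun y => fderiv ℝ v y (EuclideanSpace.single (1 : Fin 3) (1 : ℝ))) x)))) volume :=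
    (iR1.const_mul _).add (iR2.const_mul _)
  have hmono := integral_mono (iL.const_mul (M ^ 2)) iR hpt
  rw [integral_const_mul, integral_add (iR1.const_mul _) (iR2.const_mul _), integral_const_mul, integral_const_mul] at hmono
  exact hmono

end ExtremiserLiouville

end Summit.NavierStokesRegularity.NavierStokesRegularity.Theorems

end
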